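import Summits.QuantumFields.BalabanUV.T4Continuum.Support.NE3LocalCrudeWRate
import Summits.QuantumFields.BalabanUV.T4Continuum.Support.NE3EnergyWeightedSupShape
import Summits.QuantumFields.BalabanUV.T4Continuum.Support.MinimalActionClassSixEnd
import HarnessLib

/-!
# T⁴ programme, node NE3 — the LOCAL half, reading (D), crude fixed-torus route IN THE η-WEIGHTED CURRENCY (D-CRUDE-w),
# part 3 (END): `LocalRate` ∕ `NE3Shape` BY NAME FROM T-E_w♯, AND THE CAPSTONE OVER BAŁABAN's CLASS (6)

NE3 prover lineage P1, gen 20 (cell `pub-balaban`, unit `b2b-balaban-t4-ne3-p1`, row NE3 OWNER).  Sequel of parts 1–2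
(`NE3LocalCrudeWPair`, `NE3LocalCrudeWRate`); twin of (54S) `NE3LocalCrudeEnd` + (58S) §3 in the weighted currency of the
surviving variant (R3) of the repair census G-ne3p1-g19-1.  The hypothesis that replaces P2's dead root T-E is the SHAPE
**T-E_w♯** `NE3EnergyWeightedSupShape.NE3EnergyRateWSup d 𝒞 L N b g C s dom` (T-E_w + the decaying sup conjunct
`‖Z(b)‖ ≤ s·(L⁻¹)^k`), whose intended suppliers are (ML_w) ∧ (RES♯) (chart composition) and the crew's E-SUP module — none proved.

CONTENT (0 def, 0 sorry): §1 `abs_loc_succ_sub_le_of_energyRateWSup` (the per-level bound of part 2 fed by T-E_w♯ on a minimiser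
pair); §2 **`localRate_crudeW_of_energyRateWSup`** — `T4EtaRateMin.LocalRate (minActReadings 4 𝒞 L N dom loc_D) K_D^w (L⁻¹)` BY
NAME from T-E_w♯ + a regular selection of minimisers ((H∃) in choice form), reading (D) `loc_D k V x = A_{B^k({x})}(sel k V)`,
`K_D^w = K_w(W₀ = 1) + #Pl·b²` with part 2's `K_w`; §3 **`ne3Shape_crudeW_of_actionRate`** — `NE3Shape` BY NAME from the landed
action half (any constant `C_A`, rate `L⁻²`) and §2; §4 **`ne3Shape_classSix_of_energyRateWSup`** — the capstone over Bałaban's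
class (6) AS PRINTED: `NE3Shape (minActReadings d (ClassSix d L N ε₀) L N dom loc_D) (max C_A K_D^w) (L⁻¹)` at `d = 4`, `L ≥ 2`
⇐ (H∃)[choice] ∧ T-E_w♯ ∧ the regime of (58S) — TWO typed hypotheses, the second now on the live road (R3).

HONEST FRAMING.  **NE3 is NOT proved**: T-E_w♯ (⇐ (ML_w) ∧ (RES♯) ∧ (NM_λ), unproved, unprinted as such) and (H∃) (B11 Thm 1 TYPE)
are HYPOTHESES; the (D) reading is the crude fixed-torus one (constant `∝ N⁴`, no localisation δ, no (W2)); nothing printed is a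
hypothesis of a theorem; no conditional of the cell (`BetaPertH`, (B), (B^μ), G-an2-4); no `def`, no `sorry`.  Finite T⁴ rung
(B)+1 — NOT infinite volume, NOT mass gap, NOT Clay, NOT summit progress.  PLACEMENT: `Summits/QuantumFields/BalabanUV/`.  HONEST
DEPENDENCY (cell page 1): continuum YM on T⁴ ⇐ BetaPertH ∧ nine spine estimates (0/9 proved); BetaPertH ⇐ (D1) ∧ (D4) ∧ CAP+tail;
G-an2-4 gates asym, D1 and NE2/3/4.
-/

set_option autoImplicit false

open scoped BigOperators Matrix Matrix.Norms.L2Operator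
open NormedSpace Finset

namespace Summit.QuantumFields.BalabanUV.T4Continuum.NE3LocalCrudeWEnd

open Literature.MathematicalPhysics.QuantumFieldTheory.Balaban1983to89
open B7Prop1Explicit B7Prop2Explicit MatrixLog UnitaryModel
open T4AveragingDeficitWall hiding Site Plane Plaq Bond
open T4AveragingDeficitWallBoundary (periodBox)
open T4AveragingDeficitNonAbelian (wallConstNA wallConstNA_nonneg wallConstLoc)
open AveragingDeficitPeriodicCounting (IsPeriodicDir)
open AveragingDeficitDualResidual (dualC1 dualC2)
open AveragingDeficitDerivWallProof (wallConst wallConst_nonneg)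
open T4EtaRateMin (Readings ActionRate LocalRate NE3Shape)
open MinimalActionSandwich MinimalActionRate MinimalActionRefine
open SkeletonPrecompGrad (gradRem)
open MinimalActionClassSix (ClassSix)
open BlockAverageCurrent (curConst)
open NE3EnergyShapes (residualScale dualC1_nonneg dualC2_nonneg)
open NE3EnergyWeightedShapes (energyNormW)
open NE3EnergyWeightedSupShape (NE3EnergyRateWSup)
open NE3LocalCrudeEnd (iterate_blockSites_subset_periodBox card_iterate_blockSites_le abs_loc_one_sub_loc_zero_le
  actionRate_mono_rate)
open NE3LocalCrudeWRate (abs_loc_succ_sub_le_of_pairW)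
open MinimalActionClassSixEnd (actionRate_classSix_of_thm1Type)

noncomputable section

variable {d : ℕ} {n : Type*} [Fintype n] [DecidableEq n] [Nonempty n]

/-! ## §1 The per-level (D) bound from T-E_w♯ on a regular minimiser pair (d = 4) -/

/-- **THE PER-LEVEL LOCAL BOUND, READING (D), FROM T-E_w♯ AND A REGULAR MINIMISER PAIR** (`d = 4`).  Let `L, N ≥ 1`,
`0 ≤ b, c, C, s, W₀`, `20480·L²·b ≤ 1`; assume T-E_w♯ `NE3EnergyRateWSup 4 𝒞 L N b (gradConst 4 c) C s dom` (a typed HYPOTHESIS).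
For a datum `V ∈ dom`, a level `k ≥ 1`, a run-`k` minimiser `U_A`, a run-`(k+1)` minimiser `U_B` with `RegularSup 4 L N b c (k+1) U_B`
and a window `Y ⊆ [0, N·L^k)^4` of at most `W₀·(L^k)^4` sites: `|A_Y(U_A) − A_{B(Y)}(U_B)| ≤ K_w·(L⁻¹)^k` with part 2's `K_w`.
[folklore] -/
theorem abs_loc_succ_sub_le_of_energyRateWSup {𝒞 : ℕ → Set (Site 4 → Fin 4 → (Matrix n n ℂ)ˣ)} {L N : ℕ} (hL : 1 ≤ L)
    (hN : 1 ≤ N) {b c C s W₀ : ℝ} (hb : 0 ≤ b) (hc : 0 ≤ c) (hC : 0 ≤ C) (hs : 0 ≤ s) (hW₀ : 0 ≤ W₀)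
    (hbs : 20480 * (L : ℝ) ^ 2 * b ≤ 1) {dom : Set (Site 4 → Fin 4 → (Matrix n n ℂ)ˣ)}
    (hTE : NE3EnergyRateWSup 4 𝒞 L N b (gradConst 4 c) C s dom) {V : Site 4 → Fin 4 → (Matrix n n ℂ)ˣ} (hV : V ∈ dom)
    {k : ℕ} (hk : 1 ≤ k) {UA UB : Site 4 → Fin 4 → (Matrix n n ℂ)ˣ} (hA : IsMinimiser 4 𝒞 L N k V UA)
    (hB : IsMinimiser 4 𝒞 L N (k + 1) V UB) (hreg : RegularSup 4 L N b c (k + 1) UB) {Y : Finset (Site 4)}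
    (hY : Y ⊆ periodBox (N * L ^ k)) (hYc : (Y.card : ℝ) ≤ W₀ * ((L : ℝ) ^ k) ^ 4) :
    |fineAction UA (Y ×ˢ Finset.univ) - fineAction UB (blockSites L Y ×ˢ Finset.univ)|
      ≤ (wallConstLoc 4 L * W₀
            * (2500 * (L : ℝ) ^ 3 * Fintype.card (T4AveragingDeficitWall.Plane 4) * (b * c + c ^ 2) + b ^ 3)
          + ((b + 23142400 * b ^ 2) * Real.sqrt (W₀ * Fintype.card (T4AveragingDeficitWall.Plane 4))
              * (C * (wallConst 4 L * (N : ℝ) ^ 2 * (Real.sqrt (gradConst 4 c) * dualC2 4 L + 2 * b ^ 2 * dualC1 4 L)))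
            + (1 + 14 * Fintype.card (T4AveragingDeficitWall.Plane 4) * (b + 23142400 * b ^ 2)
                + 56 * Fintype.card (T4AveragingDeficitWall.Plane 4) * s
                + 912 * Fintype.card (T4AveragingDeficitWall.Plane 4) * s ^ 2 * Real.exp s ^ 2)
              * (C * (wallConst 4 L * (N : ℝ) ^ 2 * (Real.sqrt (gradConst 4 c) * dualC2 4 L + 2 * b ^ 2 * dualC1 4 L))) ^ 2))
        * ((L : ℝ)⁻¹) ^ k := by
  obtain ⟨u, Z, -, -, hZ, hZp, hrep, hE, hsup⟩ := hTE k hk V hV UA UB hA hB hreg.regular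
  exact abs_loc_succ_sub_le_of_pairW hL hN hb hc hC hs hW₀ hbs hreg hZ hZp hrep hE hsup hY hYc

/-! ## §2 `LocalRate` by name for reading (D), weighted currency -/

/-- **NE3, LOCAL HALF, READING (D) — `T4EtaRateMin.LocalRate` BY NAME, CRUDE FIXED-TORUS ROUTE, WEIGHTED CURRENCY** (`d = 4`,
rate `L⁻¹`).  Let `L, N ≥ 1`, `0 ≤ b, c, C, s`, `20480·L²·b ≤ 1`; assume T-E_w♯ `NE3EnergyRateWSup 4 𝒞 L N b (gradConst 4 c) C s dom`
(a typed HYPOTHESIS of OUR repaired frame: the η-weighted energy distance `≤ C·residualScale` AND the sup `≤ s·(L⁻¹)^k` of the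
relative direction between the gauge-fixed run-A minimiser and the averaged run-B minimiser) and a SELECTION `sel k V` of run-`k`
minimisers of every datum `V ∈ dom` with sup-form regularity `RegularSup 4 L N b c k (sel k V)` ((H∃) = B11 Thm 1 TYPE, in choice
form).  Then the readings carrier `minActReadings 4 𝒞 L N dom loc_D` with the LOCAL READING (D)
`loc_D k V x = A_{B^k({x})}(sel k V)` satisfies `LocalRate (minActReadings 4 𝒞 L N dom loc_D) K_D^w (L⁻¹)`,
`K_D^w = wallConstLoc·(2500L³·#Pl·(bc + c²) + b³) + b̃·√#Pl·R + (1 + 14#Pl·b̃ + 56#Pl·s + 912#Pl·s²(e^s)²)·R² + #Pl·b²`,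
`b̃ = b + 23142400b²`, `R = C·wallConst·N²·(√(gradConst 4 c)·dualC2 + 2b²·dualC1)` (crude: `∝ N⁴`; no localisation δ, no (W2)).
NE3 is NOT proved: T-E_w♯ and (H∃) are the hypotheses. [folklore] -/
theorem localRate_crudeW_of_energyRateWSup {𝒞 : ℕ → Set (Site 4 → Fin 4 → (Matrix n n ℂ)ˣ)} {L N : ℕ} (hL : 1 ≤ L)
    (hN : 1 ≤ N) {b c C s : ℝ} (hb : 0 ≤ b) (hc : 0 ≤ c) (hC : 0 ≤ C) (hs : 0 ≤ s) (hbs : 20480 * (L : ℝ) ^ 2 * b ≤ 1)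
    {dom : Set (Site 4 → Fin 4 → (Matrix n n ℂ)ˣ)} (hTE : NE3EnergyRateWSup 4 𝒞 L N b (gradConst 4 c) C s dom)
    {sel : ℕ → (Site 4 → Fin 4 → (Matrix n n ℂ)ˣ) → (Site 4 → Fin 4 → (Matrix n n ℂ)ˣ)}
    (hmin : ∀ V ∈ dom, ∀ k, IsMinimiser 4 𝒞 L N k V (sel k V))
    (hreg : ∀ V ∈ dom, ∀ k, RegularSup 4 L N b c k (sel k V)) :
    LocalRate
      (minActReadings 4 𝒞 L N dom
        (fun k V (x : ↥(periodBox (d := 4) N)) =>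
          fineAction (sel k V) (((blockSites L)^[k] {(x : Site 4)}) ×ˢ Finset.univ)))
      (wallConstLoc 4 L * (2500 * (L : ℝ) ^ 3 * Fintype.card (T4AveragingDeficitWall.Plane 4) * (b * c + c ^ 2) + b ^ 3)
          + ((b + 23142400 * b ^ 2) * Real.sqrt (Fintype.card (T4AveragingDeficitWall.Plane 4))
              * (C * (wallConst 4 L * (N : ℝ) ^ 2 * (Real.sqrt (gradConst 4 c) * dualC2 4 L + 2 * b ^ 2 * dualC1 4 L)))
            + (1 + 14 * Fintype.card (T4AveragingDeficitWall.Plane 4) * (b + 23142400 * b ^ 2)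
                + 56 * Fintype.card (T4AveragingDeficitWall.Plane 4) * s
                + 912 * Fintype.card (T4AveragingDeficitWall.Plane 4) * s ^ 2 * Real.exp s ^ 2)
              * (C * (wallConst 4 L * (N : ℝ) ^ 2 * (Real.sqrt (gradConst 4 c) * dualC2 4 L + 2 * b ^ 2 * dualC1 4 L))) ^ 2)
        + Fintype.card (T4AveragingDeficitWall.Plane 4) * b ^ 2)
      ((L : ℝ)⁻¹) := by
  -- the constant is non-negative
  set R : ℝ := C * (wallConst 4 L * (N : ℝ) ^ 2 * (Real.sqrt (gradConst 4 c) * dualC2 4 L + 2 * b ^ 2 * dualC1 4 L))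
    with hRdef
  have hR : 0 ≤ R := by
    have := wallConst_nonneg 4 L
    have := dualC1_nonneg 4 L
    have := dualC2_nonneg 4 L
    positivity
  have hwl : 0 ≤ wallConstLoc 4 L := by
    unfold T4AveragingDeficitNonAbelian.wallConstLoc
    have := T4AveragingDeficitNonAbelian.wallConstNA_nonneg (d := 4) L
    positivity
  set K₁ : ℝ := wallConstLoc 4 L
      * (2500 * (L : ℝ) ^ 3 * Fintype.card (T4AveragingDeficitWall.Plane 4) * (b * c + c ^ 2) + b ^ 3)
    + ((b + 23142400 * b ^ 2) * Real.sqrt (Fintype.card (T4AveragingDeficitWall.Plane 4)) * R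
      + (1 + 14 * Fintype.card (T4AveragingDeficitWall.Plane 4) * (b + 23142400 * b ^ 2)
          + 56 * Fintype.card (T4AveragingDeficitWall.Plane 4) * s
          + 912 * Fintype.card (T4AveragingDeficitWall.Plane 4) * s ^ 2 * Real.exp s ^ 2) * R ^ 2) with hK₁def
  have hK₁ : 0 ≤ K₁ := by positivity
  have hL0 : (0 : ℝ) < L := by exact_mod_cast (show 0 < L by omega)
  have hθ0 : 0 ≤ ((L : ℝ)⁻¹) := by positivity
  intro k V hV x
  have hV' : V ∈ dom := hV
  obtain ⟨x, hx⟩ := x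
  change |fineAction (sel (k + 1) V) (((blockSites L)^[k + 1] {x}) ×ˢ Finset.univ)
      - fineAction (sel k V) (((blockSites L)^[k] {x}) ×ˢ Finset.univ)|
    ≤ (K₁ + Fintype.card (T4AveragingDeficitWall.Plane 4) * b ^ 2) * ((L : ℝ)⁻¹) ^ k
  rcases k with _ | j
  · -- the level-0 step is trivial
    simp only [zero_add, Function.iterate_one, Function.iterate_zero_apply, pow_zero, mul_one]
    refine (abs_loc_one_sub_loc_zero_le hL (hreg V hV' 0).unitary (hreg V hV' 0).small (hreg V hV' 1).unitary
      (hreg V hV' 1).small x).trans ?_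
    linarith
  · -- levels `j+1 → j+2`: §1 on the window `B^{j+1}({x})` (one unit cube: `W₀ = 1`)
    have hxN : ({x} : Finset (Site 4)) ⊆ periodBox N := Finset.singleton_subset_iff.mpr hx
    have hY := iterate_blockSites_subset_periodBox (d := 4) hL hxN (j + 1)
    have hYc : ((((blockSites L)^[j + 1] {x}).card : ℕ) : ℝ) ≤ 1 * ((L : ℝ) ^ (j + 1)) ^ 4 := by
      have := card_iterate_blockSites_le (d := 4) L ({x} : Finset (Site 4)) (j + 1)
      rwa [Finset.card_singleton, Nat.cast_one] at this
    have h := abs_loc_succ_sub_le_of_energyRateWSup hL hN hb hc hC hs zero_le_one hbs hTE hV' (by omega : 1 ≤ j + 1)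
      (hmin V hV' (j + 1)) (hmin V hV' (j + 1 + 1)) (hreg V hV' (j + 1 + 1)) hY hYc
    simp only [mul_one, one_mul] at h
    rw [Function.iterate_succ_apply' (blockSites L) (j + 1) {x}, abs_sub_comm]
    refine h.trans ?_
    have h0 : 0 ≤ Fintype.card (T4AveragingDeficitWall.Plane 4) * b ^ 2 * ((L : ℝ)⁻¹) ^ (j + 1) := by positivity
    rw [add_mul]
    linarith

/-! ## §3 Both readings: `NE3Shape` by name from the landed action half and §2 -/

/-- **NE3 BY NAME ON THE FIXED TORUS, BOTH READINGS, CRUDE (D) IN THE WEIGHTED CURRENCY — MODULO THE ACTION HALF, T-E_w♯ AND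
(H∃)**: for `L ≥ 2`, if the ACTION half holds in its landed form `ActionRate (minActReadings 4 𝒞 L N dom loc_D) C_A (L⁻²)` with
`0 ≤ C_A` (e.g. `MinimalActionThm1Type.actionRate_thm1Type_class` or `MinimalActionClassSixEnd.actionRate_classSix_of_thm1Type`
at `d = 4`, which hold for EVERY local reading), and the hypotheses of §2 hold (T-E_w♯ + a regular selection of minimisers), then
`NE3Shape (minActReadings 4 𝒞 L N dom loc_D) (max C_A K_D^w) (L⁻¹)` — `T4EtaRateMin.NE3Shape` BY NAME with the honest rate
`0 ≤ L⁻¹ < 1`.  NE3 is NOT proved: the action half's (H∃), T-E_w♯ and the selection are hypotheses; (D) is the crude reading.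
[folklore] -/
theorem ne3Shape_crudeW_of_actionRate {𝒞 : ℕ → Set (Site 4 → Fin 4 → (Matrix n n ℂ)ˣ)} {L N : ℕ} (hL : 2 ≤ L)
    (hN : 1 ≤ N) {b c C s : ℝ} (hb : 0 ≤ b) (hc : 0 ≤ c) (hC : 0 ≤ C) (hs : 0 ≤ s) (hbs : 20480 * (L : ℝ) ^ 2 * b ≤ 1)
    {dom : Set (Site 4 → Fin 4 → (Matrix n n ℂ)ˣ)} (hTE : NE3EnergyRateWSup 4 𝒞 L N b (gradConst 4 c) C s dom)
    {sel : ℕ → (Site 4 → Fin 4 → (Matrix n n ℂ)ˣ) → (Site 4 → Fin 4 → (Matrix n n ℂ)ˣ)}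
    (hmin : ∀ V ∈ dom, ∀ k, IsMinimiser 4 𝒞 L N k V (sel k V))
    (hreg : ∀ V ∈ dom, ∀ k, RegularSup 4 L N b c k (sel k V)) {C_A : ℝ} (hCA : 0 ≤ C_A)
    (hA : ActionRate
      (minActReadings 4 𝒞 L N dom
        (fun k V (x : ↥(periodBox (d := 4) N)) =>
          fineAction (sel k V) (((blockSites L)^[k] {(x : Site 4)}) ×ˢ Finset.univ)))
      C_A (((L : ℝ) ^ 2)⁻¹)) :
    NE3Shape
      (minActReadings 4 𝒞 L N dom
        (fun k V (x : ↥(periodBox (d := 4) N)) =>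
          fineAction (sel k V) (((blockSites L)^[k] {(x : Site 4)}) ×ˢ Finset.univ)))
      (max C_A
        (wallConstLoc 4 L * (2500 * (L : ℝ) ^ 3 * Fintype.card (T4AveragingDeficitWall.Plane 4) * (b * c + c ^ 2) + b ^ 3)
          + ((b + 23142400 * b ^ 2) * Real.sqrt (Fintype.card (T4AveragingDeficitWall.Plane 4))
              * (C * (wallConst 4 L * (N : ℝ) ^ 2 * (Real.sqrt (gradConst 4 c) * dualC2 4 L + 2 * b ^ 2 * dualC1 4 L)))
            + (1 + 14 * Fintype.card (T4AveragingDeficitWall.Plane 4) * (b + 23142400 * b ^ 2)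
                + 56 * Fintype.card (T4AveragingDeficitWall.Plane 4) * s
                + 912 * Fintype.card (T4AveragingDeficitWall.Plane 4) * s ^ 2 * Real.exp s ^ 2)
              * (C * (wallConst 4 L * (N : ℝ) ^ 2 * (Real.sqrt (gradConst 4 c) * dualC2 4 L + 2 * b ^ 2 * dualC1 4 L))) ^ 2)
        + Fintype.card (T4AveragingDeficitWall.Plane 4) * b ^ 2))
      ((L : ℝ)⁻¹) := by
  have hL1 : 1 ≤ L := le_trans (by norm_num) hL
  have hL2 : (2 : ℝ) ≤ L := by exact_mod_cast hL
  have hL0 : (0 : ℝ) < L := by linarith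
  have hθ0 : 0 ≤ ((L : ℝ)⁻¹) := by positivity
  have hθθ : ((L : ℝ) ^ 2)⁻¹ ≤ (L : ℝ)⁻¹ := inv_anti₀ hL0 (by nlinarith)
  have hloc := localRate_crudeW_of_energyRateWSup hL1 hN hb hc hC hs hbs hTE hmin hreg
  have hK : 0 ≤ wallConstLoc 4 L
          * (2500 * (L : ℝ) ^ 3 * Fintype.card (T4AveragingDeficitWall.Plane 4) * (b * c + c ^ 2) + b ^ 3)
        + ((b + 23142400 * b ^ 2) * Real.sqrt (Fintype.card (T4AveragingDeficitWall.Plane 4))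
            * (C * (wallConst 4 L * (N : ℝ) ^ 2 * (Real.sqrt (gradConst 4 c) * dualC2 4 L + 2 * b ^ 2 * dualC1 4 L)))
          + (1 + 14 * Fintype.card (T4AveragingDeficitWall.Plane 4) * (b + 23142400 * b ^ 2)
              + 56 * Fintype.card (T4AveragingDeficitWall.Plane 4) * s
              + 912 * Fintype.card (T4AveragingDeficitWall.Plane 4) * s ^ 2 * Real.exp s ^ 2)
            * (C * (wallConst 4 L * (N : ℝ) ^ 2 * (Real.sqrt (gradConst 4 c) * dualC2 4 L + 2 * b ^ 2 * dualC1 4 L))) ^ 2)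
        + Fintype.card (T4AveragingDeficitWall.Plane 4) * b ^ 2 := by
    have := wallConst_nonneg 4 L
    have := dualC1_nonneg 4 L
    have := dualC2_nonneg 4 L
    have hwl : 0 ≤ wallConstLoc 4 L := by
      unfold T4AveragingDeficitNonAbelian.wallConstLoc
      have := T4AveragingDeficitNonAbelian.wallConstNA_nonneg (d := 4) L
      positivity
    positivity
  refine ⟨hθ0, ?_, ?_, ?_⟩
  · rw [inv_lt_one_iff₀]; right; linarith
  · exact actionRate_mono_rate hA (le_max_left _ _) hCA (by positivity) hθθ
  · exact hloc.mono (le_max_right _ _) hθ0 le_rfl hK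

/-! ## §4 The capstone over Bałaban's class (6) AS PRINTED -/

/-- **NE3 BY NAME ON THE FIXED TORUS OVER BAŁABAN's CLASS (6), BOTH READINGS, FROM (H∃) ∧ T-E_w♯ ∧ THE REGIME** — the weighted
twin of (58S) `MinimalActionClassSixEnd.ne3Shape_classSix_of_energyRate`: SAME hypotheses with P2's dead root T-E replaced by
T-E_w♯ `NE3EnergyRateWSup d (ClassSix d L N ε₀) L N b (gradConst d c) C s dom` (`0 ≤ s`).  At `d = 4`, `L ≥ 2`, `N ≥ 1`:
`NE3Shape (minActReadings d (ClassSix d L N ε₀) L N dom loc_D) (max (wallConstNA(d,L)(gradConst d 1 + 1)/L²) K_D^w) (L⁻¹)` —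
the ACTION half by `actionRate_classSix_of_thm1Type` ((H∃) ALONE + regime; (M1)(M2) kernel), the LOCAL half by §2.  TWO typed
hypotheses over Bałaban's literal class; NE3 is NOT proved by this. [folklore] -/
theorem ne3Shape_classSix_of_energyRateWSup (hd4 : d = 4) {L N : ℕ} (hL : 2 ≤ L) (hN : 1 ≤ N) {b c t B C_r C s ε₀ : ℝ}
    (hb : 0 ≤ b) (hc : 0 ≤ c) (hbt : b ≤ t) (hct : c ≤ t) (hC : 0 ≤ C) (hs : 0 ≤ s) (hB0 : 0 ≤ B) (hB4 : B ≤ 1 / 4)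
    (hBε : B < ε₀) (hCε : 2 * ((d : ℝ) - 1) * C_r < ε₀) (hCle : C_r ≤ 1)
    (hbε : b + 226 * (8 * ((d : ℝ) + 1) * (d + 4)) ^ 2 * b ^ 2 < ε₀)
    (hcε : 2 * ((d : ℝ) - 1) * (c + curConst d L * b ^ 2) < ε₀)
    (hT1 : (160 * d + 168 * (d : ℝ) ^ 2 + 2 * (32 * d + (24 * d * (2 * (d : ℝ) + gradRem d) + 14336 * (d : ℝ) ^ 2 * ((d : ℝ) + 1) ^ 2)
            + 12 * (2 * (d : ℝ) + gradRem d))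
        + 512 * ((d : ℝ) + 1) * ((d : ℝ) + 4) * (L : ℝ) ^ 2
          * (32 * d + 48 * d * (L : ℝ) ^ 2 * (2 * (d : ℝ) + gradRem d)
            + 8192 * (d : ℝ) ^ 2 * (2 * (d : ℝ) + 1) ^ 2 * (L : ℝ) ^ 2)) * t ≤ 1)
    (hT2 : 2 ^ 15 * ((d : ℝ) + 1) ^ 2 * ((d : ℝ) + 4) ^ 2 * (L : ℝ) ^ 2 * t ≤ 1)
    (hT3 : 2 ^ 14 * ((d : ℝ) + 1) * ((d : ℝ) + 4) * (L : ℝ) ^ (2 * d + 3)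
          * ((32 * d + 48 * d * (L : ℝ) ^ 2 * (2 * (d : ℝ) + gradRem d)
              + 8192 * (d : ℝ) ^ 2 * (2 * (d : ℝ) + 1) ^ 2 * (L : ℝ) ^ 2)
            + (3 * (1280 * d * ((d : ℝ) + 1) ^ 2 * ((d : ℝ) + 4) ^ 2 * (L : ℝ) ^ 2
            * (32 * d + 48 * d * (L : ℝ) ^ 2 * (2 * (d : ℝ) + gradRem d)
              + 8192 * (d : ℝ) ^ 2 * (2 * (d : ℝ) + 1) ^ 2 * (L : ℝ) ^ 2) ^ 2
          + d * ((d : ℝ) + 1) * ((L : ℝ) ^ 3 * (256 * (d : ℝ) ^ 2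
              * (32 * d + (24 * d * (2 * (d : ℝ) + gradRem d) + 14336 * (d : ℝ) ^ 2 * ((d : ℝ) + 1) ^ 2)
                + 12 * (2 * (d : ℝ) + gradRem d))
            + 4 * (24 * d * (2 * (d : ℝ) + gradRem d) + 14336 * (d : ℝ) ^ 2 * ((d : ℝ) + 1) ^ 2)
            + 24 * (2 * (d : ℝ) + gradRem d)))
          + ((d : ℝ) - 1) ^ 2 * (37 * ((d : ℝ) - 1) + 5)))) * t ≤ 1)
    (hB : ((32 * d + 48 * d * (L : ℝ) ^ 2 * (2 * (d : ℝ) + gradRem d)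
              + 8192 * (d : ℝ) ^ 2 * (2 * (d : ℝ) + 1) ^ 2 * (L : ℝ) ^ 2)
            + 8 * (3 * (1280 * d * ((d : ℝ) + 1) ^ 2 * ((d : ℝ) + 4) ^ 2 * (L : ℝ) ^ 2
            * (32 * d + 48 * d * (L : ℝ) ^ 2 * (2 * (d : ℝ) + gradRem d)
              + 8192 * (d : ℝ) ^ 2 * (2 * (d : ℝ) + 1) ^ 2 * (L : ℝ) ^ 2) ^ 2
          + d * ((d : ℝ) + 1) * ((L : ℝ) ^ 3 * (256 * (d : ℝ) ^ 2
              * (32 * d + (24 * d * (2 * (d : ℝ) + gradRem d) + 14336 * (d : ℝ) ^ 2 * ((d : ℝ) + 1) ^ 2)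
                + 12 * (2 * (d : ℝ) + gradRem d))
            + 4 * (24 * d * (2 * (d : ℝ) + gradRem d) + 14336 * (d : ℝ) ^ 2 * ((d : ℝ) + 1) ^ 2)
            + 24 * (2 * (d : ℝ) + gradRem d)))
          + ((d : ℝ) - 1) ^ 2 * (37 * ((d : ℝ) - 1) + 5))) * (L : ℝ) ^ (d + 2)) * t ≤ B)
    (hCr : (((L : ℝ) ^ 3 * (256 * (d : ℝ) ^ 2
              * (32 * d + (24 * d * (2 * (d : ℝ) + gradRem d) + 14336 * (d : ℝ) ^ 2 * ((d : ℝ) + 1) ^ 2)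
                + 12 * (2 * (d : ℝ) + gradRem d))
            + 4 * (24 * d * (2 * (d : ℝ) + gradRem d) + 14336 * (d : ℝ) ^ 2 * ((d : ℝ) + 1) ^ 2)
            + 24 * (2 * (d : ℝ) + gradRem d)))
            + 36 * (3 * (1280 * d * ((d : ℝ) + 1) ^ 2 * ((d : ℝ) + 4) ^ 2 * (L : ℝ) ^ 2
            * (32 * d + 48 * d * (L : ℝ) ^ 2 * (2 * (d : ℝ) + gradRem d)
              + 8192 * (d : ℝ) ^ 2 * (2 * (d : ℝ) + 1) ^ 2 * (L : ℝ) ^ 2) ^ 2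
          + d * ((d : ℝ) + 1) * ((L : ℝ) ^ 3 * (256 * (d : ℝ) ^ 2
              * (32 * d + (24 * d * (2 * (d : ℝ) + gradRem d) + 14336 * (d : ℝ) ^ 2 * ((d : ℝ) + 1) ^ 2)
                + 12 * (2 * (d : ℝ) + gradRem d))
            + 4 * (24 * d * (2 * (d : ℝ) + gradRem d) + 14336 * (d : ℝ) ^ 2 * ((d : ℝ) + 1) ^ 2)
            + 24 * (2 * (d : ℝ) + gradRem d)))
          + ((d : ℝ) - 1) ^ 2 * (37 * ((d : ℝ) - 1) + 5))) * (L : ℝ) ^ (d + 2)) * t ≤ C_r)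
    {dom : Set (Site d → Fin d → (Matrix n n ℂ)ˣ)}
    (hTE : NE3EnergyRateWSup d (ClassSix d L N ε₀) L N b (gradConst d c) C s dom)
    {sel : ℕ → (Site d → Fin d → (Matrix n n ℂ)ˣ) → (Site d → Fin d → (Matrix n n ℂ)ˣ)}
    (hmin : ∀ V ∈ dom, ∀ k, IsMinimiser d (ClassSix d L N ε₀) L N k V (sel k V))
    (hreg : ∀ V ∈ dom, ∀ k, RegularSup d L N b c k (sel k V)) :
    NE3Shape
      (minActReadings d (ClassSix d L N ε₀) L N dom
        (fun k V (x : ↥(periodBox (d := d) N)) =>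
          fineAction (sel k V) (((blockSites L)^[k] {(x : Site d)}) ×ˢ Finset.univ)))
      (max (wallConstNA d L * (gradConst d 1 + 1) / (L : ℝ) ^ 2)
        (wallConstLoc d L * (2500 * (L : ℝ) ^ 3 * Fintype.card (T4AveragingDeficitWall.Plane d) * (b * c + c ^ 2) + b ^ 3)
          + ((b + 23142400 * b ^ 2) * Real.sqrt (Fintype.card (T4AveragingDeficitWall.Plane d))
              * (C * (wallConst d L * (N : ℝ) ^ 2 * (Real.sqrt (gradConst d c) * dualC2 d L + 2 * b ^ 2 * dualC1 d L)))
            + (1 + 14 * Fintype.card (T4AveragingDeficitWall.Plane d) * (b + 23142400 * b ^ 2)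
                + 56 * Fintype.card (T4AveragingDeficitWall.Plane d) * s
                + 912 * Fintype.card (T4AveragingDeficitWall.Plane d) * s ^ 2 * Real.exp s ^ 2)
              * (C * (wallConst d L * (N : ℝ) ^ 2 * (Real.sqrt (gradConst d c) * dualC2 d L + 2 * b ^ 2 * dualC1 d L))) ^ 2)
        + Fintype.card (T4AveragingDeficitWall.Plane d) * b ^ 2))
      ((L : ℝ)⁻¹) := by
  subst hd4
  have hL1 : 1 ≤ L := le_trans (by norm_num) hL
  have hmin' : ∀ V ∈ dom, ∀ k, ∃ U, IsMinimiser 4 (ClassSix 4 L N ε₀) L N k V U ∧ RegularSup 4 L N b c k U :=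
    fun V hV k => ⟨sel k V, hmin V hV k, hreg V hV k⟩
  have hA := actionRate_classSix_of_thm1Type (d := 4) (by norm_num) hL1 hN hb hc hbt hct hB0 hB4 hBε hCε hCle hbε hcε
    hT1 hT2 hT3 hB hCr hmin'
    (fun k V (x : ↥(periodBox (d := 4) N)) => fineAction (sel k V) (((blockSites L)^[k] {(x : Site 4)}) ×ˢ Finset.univ))
  -- the small-field side condition of the local half from threshold (ii): `20480 ≤ 2¹⁵·5²·8² = 52428800`
  have hbs : 20480 * (L : ℝ) ^ 2 * b ≤ 1 := by
    have e : (2 : ℝ) ^ 15 * (((4 : ℕ) : ℝ) + 1) ^ 2 * (((4 : ℕ) : ℝ) + 4) ^ 2 * (L : ℝ) ^ 2 * t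
        = 52428800 * ((L : ℝ) ^ 2 * t) := by
      push_cast; ring
    have h2 : 52428800 * ((L : ℝ) ^ 2 * t) ≤ 1 := by rw [← e]; exact hT2
    have hL2 : (0 : ℝ) ≤ (L : ℝ) ^ 2 := by positivity
    have h3 : (L : ℝ) ^ 2 * b ≤ (L : ℝ) ^ 2 * t := mul_le_mul_of_nonneg_left hbt hL2
    have h4 : 0 ≤ (L : ℝ) ^ 2 * b := mul_nonneg hL2 hb
    have h5 : 20480 * (L : ℝ) ^ 2 * b = 20480 * ((L : ℝ) ^ 2 * b) := by ring
    rw [h5]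
    linarith only [h2, h3, h4]
  have hCA : 0 ≤ wallConstNA 4 L * (gradConst 4 1 + 1) / (L : ℝ) ^ 2 := by
    have := wallConstNA_nonneg (d := 4) L
    have := gradConst_nonneg (d := 4) (1 : ℝ)
    positivity
  exact ne3Shape_crudeW_of_actionRate hL hN hb hc hC hs hbs hTE hmin hreg hCA hA

end

end Summit.QuantumFields.BalabanUV.T4Continuum.NE3LocalCrudeWEnd
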